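import Literature.AlgebraicGeometry.HodgeTheory.MonomialSupportedHypersurfaceMonodromy
import Literature.AlgebraicGeometry.HodgeTheory.UniversalHypersurfaceDiscriminant
import Literature.AlgebraicGeometry.FundamentalGroup.HypersurfaceComplementMeridians
import Summits.HodgeConjecture.HodgeConjecture.Theorems.SignSymmetricPowersMeridianOneNode
import HarnessLib

/-!
# K1-B meridian package II — the coefficient chart of the `M`-supported base (route `SignSymmetricPowers`,
# item stmt-HodgeConjecture-19716): `S_M(ℂ)` is homeomorphic to the complement of the irreducible
# hypersurfaces cut out by the prime factors of the restricted discriminant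

Helper file (`--supports stmt-HodgeConjecture-19716`) for the open stubs GEN (`stub_signMeridianGeneration`) and
LINK (`stub_signConfluenceLinkG`) of the K1-B line `andre-zariski`: step H1 of memo K1B-GEN-STUBPLAN-g23 / §3 of
K1B-LINKF-PLAN-g23 — the presentation of `S_M(ℂ)` (complex points of the base `baseM ℂ n d M` of the family of
smooth `M`-supported degree-`d` hypersurfaces of `ℙⁿ⁺¹`) as the arrangement complement
`affineHypersurfaceComplement h ⊂ ℂ^M` to which the Zariski–van Kampen facts
(`FundamentalGroup/HypersurfaceComplementMeridians`) and the `Meridian` structure apply.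

* §1 `exists_irreducible_factors` — a non-zero `D ∈ ℂ[a]` is `w · ∏ⱼ hⱼ` with `w` a unit and the `hⱼ` irreducible
  (prime factors with multiplicity, `UniqueFactorizationMonoid.factors`), and `{D ≠ 0} = affineHypersurfaceComplement h`.
* §2 `isEmbedding_coeffChart` — the chart `t ↦ (t(a_m))_{m ∈ M}`, `S_M(ℂ) → ℂ^M`, is a topological embedding
  (`isEmbedding_map_toBase`, `isEmbedding_coeffVector`, inverted on its image by extension by zero);
  `range_coeffChart_eq` — its image is `{D_M ≠ 0}`, `D_M := killHom Disc` the restriction to `A_M` of any equation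
  `Disc` of the discriminant (`singularCoeffs = V(Disc)`, F-DISC-0); **`exists_homeomorph_affineHypersurfaceComplement`**
  — hence a homeomorphism `e : S_M(ℂ) ≃ₜ affineHypersurfaceComplement h` onto the complement of the prime factors
  `hⱼ` of `D_M` (all irreducible; `D_M = w ∏ hⱼ`, `w` a unit), which IS the chart on points.  With
  `SignSymmetricPowersMeridianOneNode.exists_unique_factor_pencil` this gives the `Meridian` fields at one-node centres.

Sorry-free; axioms standard; no definition, no named fact (the discriminant equation is a hypothesis).

## References

* [VoisinHodgeII2003] C. Voisin, Hodge Theory and Complex Algebraic Geometry II (CUP 2003), §6.2.1.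
* [EisenbudHarris2016] D. Eisenbud, J. Harris, 3264 and All That (CUP 2016), §7.1 Prop. 7.1.
* [Shimada2010ZvK] I. Shimada, Lectures on Zariski–van Kampen theorem (arXiv:0906.1074), §3 Prop. 3.4.
* [SerreGAGA1956] J.-P. Serre, GAGA, §2 n°5.
-/

noncomputable section

set_option linter.dupNamespace false

open MvPolynomial Topology
open Literature.AlgebraicGeometry.Motives Literature.AlgebraicGeometry.Motives.UniversalHypersurface
open Literature.AlgebraicGeometry.HodgeTheory Literature.AlgebraicGeometry.HodgeTheory.UniversalHypersurface
open Literature.AlgebraicGeometry.FundamentalGroup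
open Summit.HodgeConjecture.HodgeConjecture.Theorems.SignSymmetricPowersMeridianOneNode

namespace Summit.HodgeConjecture.HodgeConjecture.Theorems.SignSymmetricPowersMeridianChart

/-! ### §1 The zero-free locus of a polynomial is the complement of its irreducible factors -/

section Factors

variable {σ : Type}

/-- **Prime factorisation as a hypersurface arrangement**: a non-zero `D ∈ ℂ[a]` is a unit times a finite
product of irreducible polynomials `hⱼ` (repetitions allowed), and `{D ≠ 0}` is the complement
`affineHypersurfaceComplement h = {a | ∀ j, hⱼ(a) ≠ 0}` of the listed hypersurfaces — the setting of the
Zariski–van Kampen facts `affineHypersurfaceComplement_meridians_normalClosure_eq_top` /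
`affineHypersurfaceComplement_meridian_isConj`. [cite: Shimada2010ZvK, §3 Prop. 3.4] -/
theorem exists_irreducible_factors [DecidableEq σ] [DecidableEq (MvPolynomial σ ℂ)] (D : MvPolynomial σ ℂ)
    (hD : D ≠ 0) :
    ∃ (m : ℕ) (h : Fin m → MvPolynomial σ ℂ) (w : MvPolynomial σ ℂ), IsUnit w ∧ (∀ j, Irreducible (h j)) ∧
      D = w * ∏ j, h j ∧ ∀ a : σ → ℂ, MvPolynomial.eval a D ≠ 0 ↔ a ∈ affineHypersurfaceComplement h := by
  obtain ⟨u, hu⟩ := UniqueFactorizationMonoid.factors_prod hD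
  set l := (UniqueFactorizationMonoid.factors D).toList with hl
  refine ⟨l.length, fun j => l.get j, (u : MvPolynomial σ ℂ), u.isUnit, fun j => ?_, ?_, fun a => ?_⟩
  · exact UniqueFactorizationMonoid.irreducible_of_factor _
      (Multiset.mem_toList.1 (List.get_mem l j))
  · have hprod : ∏ j, l.get j = (UniqueFactorizationMonoid.factors D).prod := by
      rw [← List.prod_ofFn, List.ofFn_get, Multiset.prod_toList]
    rw [hprod, mul_comm]
    exact hu.symm
  · have hprod : ∏ j, l.get j = (UniqueFactorizationMonoid.factors D).prod := by
      rw [← List.prod_ofFn, List.ofFn_get, Multiset.prod_toList]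
    rw [mem_affineHypersurfaceComplement_iff, ← hu, map_mul, ← hprod, map_prod, mul_ne_zero_iff,
      Finset.prod_ne_zero_iff]
    have huu : MvPolynomial.eval a (u : MvPolynomial σ ℂ) ≠ 0 :=
      (u.isUnit.map (MvPolynomial.eval a)).ne_zero
    simp only [Finset.mem_univ, true_imp_iff]
    exact ⟨fun hh => hh.1, fun hh => ⟨hh, huu⟩⟩

end Factors

/-! ### §2 The chart `S_M(ℂ) → ℂ^M` -/

section Chart

variable (n d : ℕ) (M : Set (DegIndex n d)) [DecidablePred (· ∈ M)]

/-- The extension by zero of the `M`-coefficient chart of `t ∈ S_M(ℂ)` is the full coefficient vector of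
`g_M t ∈ U(ℂ)`. [cite: VoisinHodgeII2003, §6.2.1] -/
theorem extend_coeffChart (t : ComplexPoints (baseM ℂ n d M)) :
    (fun m : DegIndex n d => if h : m ∈ M then
        ((coeffVector ℂ n d (AlgPoints.map (toBase ℂ n d M) t)) ∘ (Subtype.val : M → DegIndex n d)) ⟨m, h⟩ else 0) =
      coeffVector ℂ n d (AlgPoints.map (toBase ℂ n d M) t) := by
  funext m
  by_cases hm : m ∈ M
  · rw [dif_pos hm, Function.comp_apply]
  · rw [dif_neg hm, coeffVector_map_toBase_of_not_mem ℂ n d M t hm]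

/-- Extension by zero `ℂ^M → ℂ^{DegIndex}` is continuous. [folklore] -/
theorem continuous_extendByZero :
    Continuous fun a : M → ℂ => fun m : DegIndex n d => if h : m ∈ M then a ⟨m, h⟩ else 0 := by
  refine continuous_pi fun m => ?_
  by_cases hm : m ∈ M
  · simp only [dif_pos hm]; exact continuous_apply _
  · simp only [dif_neg hm]; exact continuous_const

/-- **The coefficient chart `t ↦ (t(a_m))_{m ∈ M}` of `S_M(ℂ)` is a topological embedding into `ℂ^M`**
(`g_M : S_M(ℂ) ↪ U(ℂ)` and `coeffVector : U(ℂ) ↪ ℂ^{DegIndex}` are embeddings, and on the image the restriction to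
the `M`-coordinates is inverted by extension by zero). [cite: SerreGAGA1956, §2 n°5] [cite: VoisinHodgeII2003, §6.2.1] -/
theorem isEmbedding_coeffChart :
    IsEmbedding fun t : ComplexPoints (baseM ℂ n d M) =>
      (coeffVector ℂ n d (AlgPoints.map (toBase ℂ n d M) t)) ∘ (Subtype.val : M → DegIndex n d) := by
  have hΨ : IsEmbedding fun t : ComplexPoints (baseM ℂ n d M) => coeffVector ℂ n d (AlgPoints.map (toBase ℂ n d M) t) :=
    (isEmbedding_coeffVector ℂ n d).comp (isEmbedding_map_toBase ℂ n d M)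
  have hcont : Continuous fun t : ComplexPoints (baseM ℂ n d M) =>
      (coeffVector ℂ n d (AlgPoints.map (toBase ℂ n d M) t)) ∘ (Subtype.val : M → DegIndex n d) :=
    (continuous_pi fun m : M => continuous_apply m.1).comp hΨ.continuous
  refine IsEmbedding.of_comp hcont (continuous_extendByZero n d M) ?_
  have heq : ((fun a : M → ℂ => fun m : DegIndex n d => if h : m ∈ M then a ⟨m, h⟩ else 0) ∘
      fun t : ComplexPoints (baseM ℂ n d M) =>
        (coeffVector ℂ n d (AlgPoints.map (toBase ℂ n d M) t)) ∘ (Subtype.val : M → DegIndex n d)) =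
      fun t => coeffVector ℂ n d (AlgPoints.map (toBase ℂ n d M) t) :=
    funext fun t => extend_coeffChart n d M t
  rw [heq]
  exact hΨ

/-- **The image of the chart is the zero-free locus of the restricted discriminant** `D_M = killHom Disc`
(for any equation `Disc` of the discriminant, `singularCoeffs = V(Disc)`, e.g. F-DISC-0's).
[cite: EisenbudHarris2016, §7.1 Prop. 7.1] [cite: VoisinHodgeII2003, §6.2.1] -/
theorem range_coeffChart_eq {Disc : MvPolynomial (DegIndex n d) ℂ}
    (hV : ∀ a : DegIndex n d → ℂ, a ∈ singularCoeffs n d ↔ MvPolynomial.eval a Disc = 0) :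
    Set.range (fun t : ComplexPoints (baseM ℂ n d M) =>
      (coeffVector ℂ n d (AlgPoints.map (toBase ℂ n d M) t)) ∘ (Subtype.val : M → DegIndex n d)) =
      {a : M → ℂ | MvPolynomial.eval a (killHom ℂ n d M Disc) ≠ 0} := by
  rw [range_coeffVector_map_toBase_restrict]
  ext a
  rw [Set.mem_setOf_eq, Set.mem_setOf_eq, eval_killHom, ne_eq, ← hV, mem_singularCoeffs_iff, not_not]

/-- **`S_M(ℂ)` is homeomorphic, through the coefficient chart, to the complement `{a ∈ ℂ^M | ∀ j, hⱼ(a) ≠ 0}` of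
the irreducible hypersurfaces cut out by the prime factors `hⱼ` of the restricted discriminant `D_M = killHom Disc`**
(`D_M = w ∏ hⱼ`, `w` a unit) — the arrangement to which the Zariski–van Kampen facts and the `Meridian` structure
apply.  Requires `S_M(ℂ) ≠ ∅` (so that `D_M ≠ 0`). [cite: Shimada2010ZvK, §3 Prop. 3.4]
[cite: VoisinHodgeII2003, §6.2.1] [cite: EisenbudHarris2016, §7.1 Prop. 7.1] -/
theorem exists_homeomorph_affineHypersurfaceComplement [DecidableEq (MvPolynomial M ℂ)]
    {Disc : MvPolynomial (DegIndex n d) ℂ}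
    (hV : ∀ a : DegIndex n d → ℂ, a ∈ singularCoeffs n d ↔ MvPolynomial.eval a Disc = 0)
    (hne : Nonempty (ComplexPoints (baseM ℂ n d M))) :
    ∃ (m : ℕ) (h : Fin m → MvPolynomial M ℂ) (w : MvPolynomial M ℂ), IsUnit w ∧ (∀ j, Irreducible (h j)) ∧
      killHom ℂ n d M Disc = w * ∏ j, h j ∧
      ∃ e : ComplexPoints (baseM ℂ n d M) ≃ₜ affineHypersurfaceComplement h,
        ∀ t, ((e t : affineHypersurfaceComplement h) : M → ℂ) =
          (coeffVector ℂ n d (AlgPoints.map (toBase ℂ n d M) t)) ∘ (Subtype.val : M → DegIndex n d) := by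
  classical
  have hrange := range_coeffChart_eq n d M hV
  have hD : killHom ℂ n d M Disc ≠ 0 := by
    obtain ⟨t⟩ := hne
    intro h0
    have ht : (coeffVector ℂ n d (AlgPoints.map (toBase ℂ n d M) t)) ∘ (Subtype.val : M → DegIndex n d) ∈
        Set.range (fun t : ComplexPoints (baseM ℂ n d M) =>
          (coeffVector ℂ n d (AlgPoints.map (toBase ℂ n d M) t)) ∘ (Subtype.val : M → DegIndex n d)) := ⟨t, rfl⟩
    rw [hrange, Set.mem_setOf_eq, h0, map_zero] at ht
    exact ht rfl
  obtain ⟨m, h, w, hw, hirr, hfac, hiff⟩ := exists_irreducible_factors (killHom ℂ n d M Disc) hD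
  have hrange' : Set.range (fun t : ComplexPoints (baseM ℂ n d M) =>
      (coeffVector ℂ n d (AlgPoints.map (toBase ℂ n d M) t)) ∘ (Subtype.val : M → DegIndex n d)) =
      affineHypersurfaceComplement h := by
    rw [hrange]
    ext a
    exact hiff a
  refine ⟨m, h, w, hw, hirr, hfac, (isEmbedding_coeffChart n d M).toHomeomorph.trans (Homeomorph.setCongr hrange'),
    fun t => rfl⟩

end Chart

end Summit.HodgeConjecture.HodgeConjecture.Theorems.SignSymmetricPowersMeridianChart

end
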